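import Literature.NumberTheory.Rogawski1990.ArchHcJumpRelabel               -- (B-rel) (this seat): `archHcJump_clause_pair_swap`, `archHcJump_clause_slot_swap`; brings ★ p850984 (I₃)₀ (`noncompactPair_cases`, `archERhoG_mul_eq_neg_hcSwapAt_of_archHcWeyl`), ★ GDocks
import Literature.NumberTheory.Rogawski1990.ArchDeltaTransferOfChartRead      -- ★ p850246 (LH7-p01 (g2)): frame facts `ne_zero_of_diagonal_anisotropic`, `complexConj_apply_eq_of_diagonal_frame`
import HarnessLib

/-!
# (B-asm) `jc′` UNIVERSALITY + GUARDS + ASSEMBLY for Harish-Chandra's jump clause (I₃) of the extended genuine orbital families `orbFamGExt ν′ a′`: from the jump relations at the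
# walls `(w, 0, 2)` of the admissible charts to `∃ jc′, ∀ a′, ArchHcJump (slotSign L α) jc′ (orbFamGExt ν′ a′)` and to the letter L1 `∃ jc′, ∀ a′, ArchHCSpaceG (slotSign L α) jc′ (orbFamGExt ν′ a′)`
# (Harish-Chandra ∕ Varadarajan 1977 I §1.12; Shelstad 1979 §4 Prop. 4.5, Thm. 4.7; Bouaziz 1994 §3.2 (I₃), Thm. 3.2.1)

Topic `NumberTheory/Rogawski1990`; namespace `Literature.NumberTheory.Rogawski1990`.  THEOREMS ONLY (no `def`, no instance, no notation, no axiom, no named fact, no `sorry`);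
kernel lane `--kind proof --supports stmt-HodgeConjecture-24833`.  Cell `pub/hodgecm-mathlib`, crux H413 (`stmt-HodgeConjecture-24833`), F0∕P3c line LH3 (closer stub `stub_N9`,
DIRECT ROAD `F0_P3c_StubN9Direct` ED. v4, letter L1 `stub_N9hcOrbitalFamilies : HcOrbitalFamiliesStatement`); brick **(B-asm)** of the (I₃) spec of record (F0P3a-p08 (g23)
`SPEC-I3-jumps` v1∕v1.1; LH3-plan (g3) RULINGS #14 ∕ #16 (f), 2026-09-02T10:08:47Z).  Author LH3-p03 (g5).

THE MATHEMATICS.  The letter L1 asks for ONE jump datum `jc′ : Finset W → W → Fin 3 → Fin 3 → ℂ` such that EVERY test function `a′ ∈ C_c^∞(G′_∞)` has its extended `R′`-normalised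
orbital family ★ `orbFamGExt ν′ a′` in Harish-Chandra's space ★ `ArchHCSpaceG (slotSign L α) jc′`, whose clause (I₃) ★ `ArchHcJump` quantifies over EVERY chart label `S′`, EVERY
compact place `w ∉ S′`, EVERY ordered pair `i ≠ j` with `slotSign w i ≠ slotSign w j`, every semiregular wall point, order and word.  The analytic content (Harish-Chandra
descent + the rank-one Casimir ladder, bricks (B-desc)∕(B-norm)∕(B-trans)∕(B-r1) of the spec) delivers the relation at the wall `(w, 0, 2)` of an ADMISSIBLE chart (`S′ ⊆`
★ `splitChartPlaces`, `w` a split-chart place), with ONE constant `J(S′, w)` chosen BEFORE `a′` (the descent constants are chart data — spec §4 (G3); (G′-CANCEL) ★ p850673).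
This file does the rest, which is bookkeeping:
* UNIVERSALITY: `∀ (S′, w) ∃ J ∀ a′ …` ⟹ `∃ jc′ ∀ a′ …` (`choose`; the axiom of choice is in the TRIO);
* GUARDS: on a NON-admissible label both sides of (I₃) vanish (★ `orbFamGExt_of_not_admissible` for `S′` and for `insert w S′`); on an admissible label the sign guard
  `slotSign w i ≠ slotSign w j` makes `w` indefinite, hence a split-chart place (★ `mem_splitChartPlaces_of_frame` with the frame facts `α_i ≠ 0`, `σ_w(α_i) ∈ ℝ` read off the
  hermitian anisotropic diagonal frame), where `slotSign w 0 = slotSign w 1 ≠ slotSign w 2` (★ `slotSign_of_mem_splitChartPlaces`), so the noncompact ordered pairs are exactly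
  `(0,2), (2,0), (1,2), (2,1)` (★ `noncompactPair_cases`);
* RELABEL: the three other pairs from `(0, 2)` by (B-rel) (`ArchHcJumpRelabel`): `jc′₂₀ = −J`, `jc′₁₂ = −J`, `jc′₂₁ = J`, using only HC's (W) symmetries of the genuine family
  (★ `archHcWeyl_orbFamGExt`: evenness in `x_w` of the split member; the flip `'F∘(0 1) = −'F` on `RegG` ★ `archERhoG_mul_eq_neg_hcSwapAt_of_archHcWeyl`);
* ASSEMBLY with (I₁): ★ `archHCSpaceG_orbFamGExt_iff_smoothBounded_and_jump` ((P), (W), (I₄) are theorems ★ p850216; the one-sided existence half of (I₁) follows from (I₃)).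
HEADS: `exists_archHcJump_orbFamGExt` (⇒ `∃ jc′, ∀ a′, ArchHcJump`), `exists_archHCSpaceG_orbFamGExt` (+ the chart-wise «`C^∞` on `InRegG` with bounded jets» hypothesis (I₁) ⇒
`∃ jc′, ∀ a′, ArchHCSpaceG`) — the latter is, after `intro L … hherm hanis`, LITERALLY the body of the leaf's `HcOrbitalFamiliesStatement`; both in the binder frame of the leaf
(`hherm`, `hanis`, `ν′` Haar).  The two hypotheses `h1` ((I₁), socket ★ `smoothBounded_orbFamGExt_of_forall_wall` p850995) and `h02` ((I₃) at `(w,0,2)`, socket of (B-trans)) are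
the exact deliverables of the letter's pay-down; nothing else is owed to L1.
HONEST LABEL: HC_CM is proved only modulo the 7 printed citations (2 remaining: hLiu418 = `stmt-HodgeConjecture-24832`, h413 = `stmt-HodgeConjecture-24833`) until rung 0 closes;
count-neutral letter-L1 pay-down (assembly; the two analytic inputs are hypotheses here).

## References
* [Varadarajan1977] V. S. Varadarajan, *Harmonic Analysis on Real Reductive Groups*, LNM 576 (1977), Part I §1.12 (the invariant integral `'F_f`, its jump relations).
* [Shelstad1979] D. Shelstad, *Characters and inner forms of a quasi-split group over ℝ*, Compositio Math. 39 (1979) 11–45, §4: Prop. 4.5 p. 26 (`d(α)`), Thm. 4.7 p. 31.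
* [Bouaziz1994IntegralesOrbitales] A. Bouaziz, *Intégrales orbitales sur les groupes de Lie réductifs*, Ann. Sci. ÉNS (4) 27 (1994) 573–609, §3.2 (I₃) p. 580 («`J_G(φ) ∈ I(U)`»),
  Thm. 3.2.1 p. 581.
* [Rogawski1990] J. D. Rogawski, *Automorphic Representations of Unitary Groups in Three Variables*, Ann. of Math. Stud. 123 (1990), §3.6 p. 31, §14.2 p. 232 (the frame).
-/

set_option autoImplicit false

noncomputable section

open MeasureTheory MeasureTheory.Measure NumberField NumberField.InfinitePlace Matrix Complex Set Filter Topology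
open scoped MatrixGroups Matrix ContDiff Classical
open Literature.NumberTheory.Automorphic Literature.NumberTheory.Automorphic.UnitaryGroup Literature.NumberTheory.Automorphic.ArchCartan
open Literature.NumberTheory.Automorphic.Shelstad1979.StableOrbitalIntegrals
open Literature.NumberTheory.GaloisRepresentations

namespace Literature.NumberTheory.Rogawski1990

section Assembly

variable (L : Type) [Field L] [NumberField L] [IsCMField L] (α : Fin 3 → L)
  [MeasurableSpace ↥(arch (↥(maximalRealSubfield L)) L (IsCMField.complexConj L) 3 (Matrix.diagonal α))] [BorelSpace ↥(arch (↥(maximalRealSubfield L)) L (IsCMField.complexConj L) 3 (Matrix.diagonal α))]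
  (ν' : Measure ↥(arch (↥(maximalRealSubfield L)) L (IsCMField.complexConj L) 3 (Matrix.diagonal α))) [ν'.IsHaarMeasure] [ν'.IsMulRightInvariant]

/-- **(I₃) FOR ONE TEST FUNCTION FROM THE `(0, 2)`-WALLS OF THE ADMISSIBLE CHARTS** (guards + relabel, the constant GIVEN as a function `J` of the admissible pair `(S′, w)`):
if at every wall `(w, 0, 2)` (`S′` admissible, `w ∉ S′` a split-chart place) the twisted word derivatives of `orbFamGExt ν′ a′` jump by `J S′ w · hcCayScalar · (Cayley word
derivative)`, then `ArchHcJump (slotSign L α) jc′ (orbFamGExt ν′ a′)` holds for the datum `jc′ S′ w i j = ε i j · J S′ w` on admissible `(S′, w)` (`ε₀₂ = ε₂₁ = 1`, `ε₂₀ = ε₁₂ = −1`)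
and `0` elsewhere. [cite: Shelstad1979, Prop. 4.5 (p. 26); Thm. 4.7 (p. 31)] [cite: Bouaziz1994IntegralesOrbitales, §3.2 (I₃) p. 580] [cite: Varadarajan1977, I §1.12] -/
theorem archHcJump_orbFamGExt_of_wall02
    (hherm : ((Matrix.diagonal α).map (cmConjRingHom L)).transpose = Matrix.diagonal α)
    (hanis : ∀ x : Fin 3 → L, Literature.AlgebraicGeometry.ShimuraVarieties.hermForm (cmConjRingHom L) (Matrix.diagonal α) x x = 0 → x = 0)
    {a' : ↥(arch (↥(maximalRealSubfield L)) L (IsCMField.complexConj L) 3 (Matrix.diagonal α)) → ℂ}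
    (J : Finset {w : InfinitePlace L // IsComplex w} → {w : InfinitePlace L // IsComplex w} → ℂ)
    (h02 : ∀ S' : Finset {w : InfinitePlace L // IsComplex w}, (∀ w, w ∈ S' → w ∈ splitChartPlaces L α) →
      ∀ w : {w : InfinitePlace L // IsComplex w}, w ∉ S' → w ∈ splitChartPlaces L α →
        ∀ p : {w : InfinitePlace L // IsComplex w} → Fin 3 → ℝ, HcSemireg S' w 0 2 p → ∀ (n : ℕ) (m : Fin n → {w : InfinitePlace L // IsComplex w} × Fin 3),
          HasOneSidedJump
            (fun ν : ℝ => hcTwistedDeriv S' n (fun r => hcAdaptedVec w 0 2 (m r)) (orbFamGExt L α ν' a' S') (p + ν • hcNrm w 0 2))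
            (J S' w * hcCayScalar w 0 m * hcTwistedDeriv (insert w S') n (fun r => hcCayVec w 0 2 (m r)) (orbFamGExt L α ν' a' (insert w S')) (hcCayPt w 0 2 p))) :
    ArchHcJump (slotSign L α)
      (fun S' w i j => if (∀ v, v ∈ S' → v ∈ splitChartPlaces L α) ∧ w ∈ splitChartPlaces L α then
        (if i = 0 ∧ j = 2 ∨ i = 2 ∧ j = 1 then 1 else if i = 2 ∧ j = 0 ∨ i = 1 ∧ j = 2 then -1 else 0 : ℂ) * J S' w else 0)
      (orbFamGExt L α ν' a') := by
  have hα : ∀ i, α i ≠ 0 := ne_zero_of_diagonal_anisotropic hanis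
  have hreal : ∀ (w : {w : InfinitePlace L // IsComplex w}) (i : Fin 3), (w.1.embedding (α i)).im = 0 :=
    fun w i => im_embedding_diagonal_eq_zero L 3 α (complexConj_apply_eq_of_diagonal_frame hherm) w i
  intro S' w hw i j hij hsij p hp n m
  by_cases hadm : ∀ v, v ∈ S' → v ∈ splitChartPlaces L α
  swap
  · -- a non-admissible chart: both members vanish identically
    have hadm' : ¬ ∀ v, v ∈ insert w S' → v ∈ splitChartPlaces L α :=
      fun h => hadm fun v hv => h v (Finset.mem_insert_of_mem hv)
    rw [orbFamGExt_of_not_admissible L α ν' a' S' hadm, orbFamGExt_of_not_admissible L α ν' a' (insert w S') hadm']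
    refine ⟨0, 0, ?_, ?_, ?_⟩
    · simp only [hcTwistedDeriv_fun_zero]; exact tendsto_const_nhds
    · simp only [hcTwistedDeriv_fun_zero]; exact tendsto_const_nhds
    · rw [hcTwistedDeriv_fun_zero, mul_zero, sub_zero]
  -- an admissible chart; `w` is indefinite for `diag α`, hence a split-chart place, and `slotSign w 0 = slotSign w 1 ≠ slotSign w 2`
  have hind : ¬ (formSign L α w 0 = formSign L α w 1 ∧ formSign L α w 1 = formSign L α w 2) := by
    rintro ⟨h01, h12⟩
    have hall : ∀ k : Fin 3, formSign L α w k = formSign L α w 0 := by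
      intro k
      fin_cases k
      · rfl
      · exact h01.symm
      · exact h12.symm.trans h01.symm
    apply hsij
    rw [slotSign_apply, slotSign_apply, hall (lineOf (formSign L α w) i), hall (lineOf (formSign L α w) j)]
  have hwsp : w ∈ splitChartPlaces L α := mem_splitChartPlaces_of_frame hα (hreal w) hind
  obtain ⟨h10, -, -⟩ := slotSign_of_mem_splitChartPlaces L α hα hwsp
  have hs01 : slotSign L α w 0 = slotSign L α w 1 := h10.symm
  have hW : ArchHcWeyl (slotSign L α) (orbFamGExt L α ν' a') := archHcWeyl_orbFamGExt L α ν' hα hreal a'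
  -- (W): the split member is even in `x_w`; the twisted compact member flips under the realised reflection `(0 1)` on `RegG S′`
  have heven : ∀ c, orbFamGExt L α ν' a' (insert w S') (negXAt w c) = orbFamGExt L α ν' a' (insert w S') c :=
    fun c => hW.2 (insert w S') c w (Finset.mem_insert_self w S')
  have hflip : ∀ c ∈ RegG S', archERhoG S' (hcSwapAt w 0 1 c) * orbFamGExt L α ν' a' S' (hcSwapAt w 0 1 c) = -(archERhoG S' c * orbFamGExt L α ν' a' S' c) := by
    intro c hc
    have h := archERhoG_mul_eq_neg_hcSwapAt_of_archHcWeyl hW hw hs01 (c := hcSwapAt w 0 1 c) (by rwa [hcSwapAt_hcSwapAt])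
    rwa [hcSwapAt_hcSwapAt] at h
  -- the clause at the four noncompact pairs
  have H02 := h02 S' hadm w hw hwsp
  have H20 := archHcJump_clause_pair_swap (show (0 : Fin 3) ≠ 2 by decide) heven H02
  have H12 := archHcJump_clause_slot_swap hw (show (0 : Fin 3) ≠ 2 by decide) (show (0 : Fin 3) ≠ 1 by decide) (show (2 : Fin 3) ≠ 1 by decide) hflip H02
  have H21 := archHcJump_clause_pair_swap (show (1 : Fin 3) ≠ 2 by decide) heven H12
  simp only [if_pos (show (∀ v, v ∈ S' → v ∈ splitChartPlaces L α) ∧ w ∈ splitChartPlaces L α from ⟨hadm, hwsp⟩)]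
  rcases noncompactPair_cases hs01 hij hsij with ⟨rfl, rfl⟩ | ⟨rfl, rfl⟩ | ⟨rfl, rfl⟩ | ⟨rfl, rfl⟩
  · rw [if_pos (by decide), one_mul]
    exact H02 p hp n m
  · rw [if_neg (by decide), if_pos (by decide), neg_one_mul]
    exact H20 p hp n m
  · rw [if_neg (by decide), if_pos (by decide), neg_one_mul]
    exact H12 p hp n m
  · rw [if_pos (by decide), one_mul]
    have h := H21 p hp n m
    rw [neg_neg] at h
    exact h

/-- **`jc′` UNIVERSALITY + GUARDS + ASSEMBLY ⇒ (I₃) FOR ALL TEST FUNCTIONS WITH ONE DATUM.**  If at every wall `(w, 0, 2)` of every ADMISSIBLE chart (`S′ ⊆ splitChartPlaces`, `w ∉ S′` a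
split-chart place) there is ONE constant `J` — chosen before the test function — such that for every `a′ ∈ C_c^∞(G′_∞)`, every semiregular wall point `p`, every order `n` and every
word `m` the twisted word derivative of `orbFamGExt ν′ a′ S′` along `p + ν•hcNrm w 0 2` jumps by `J · hcCayScalar w 0 m · Dⁿ'F_{S′∪w}(hcCayPt w 0 2 p)(hcCayVec ∘ m)`, then there is ONE
jump datum `jc′` with `ArchHcJump (slotSign L α) jc′ (orbFamGExt ν′ a′)` for EVERY `a′` (all charts, all noncompact ordered pairs: junk labels vanish on both sides, definite places
carry no noncompact pair, the pairs `(2,0), (1,2), (2,1)` follow from `(0,2)` by HC's (W) symmetries — (B-rel)). [cite: Varadarajan1977, I §1.12] [cite: Shelstad1979, Thm. 4.7 (p. 31)]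
[cite: Bouaziz1994IntegralesOrbitales, §3.2 (I₃) p. 580] -/
theorem exists_archHcJump_orbFamGExt
    (hherm : ((Matrix.diagonal α).map (cmConjRingHom L)).transpose = Matrix.diagonal α)
    (hanis : ∀ x : Fin 3 → L, Literature.AlgebraicGeometry.ShimuraVarieties.hermForm (cmConjRingHom L) (Matrix.diagonal α) x x = 0 → x = 0)
    (h02 : ∀ S' : Finset {w : InfinitePlace L // IsComplex w}, (∀ w, w ∈ S' → w ∈ splitChartPlaces L α) →
      ∀ w : {w : InfinitePlace L // IsComplex w}, w ∉ S' → w ∈ splitChartPlaces L α →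
        ∃ J : ℂ, ∀ a' : ↥(arch (↥(maximalRealSubfield L)) L (IsCMField.complexConj L) 3 (Matrix.diagonal α)) → ℂ, ArchSmooth L 3 (Matrix.diagonal α) a' →
          ∀ p : {w : InfinitePlace L // IsComplex w} → Fin 3 → ℝ, HcSemireg S' w 0 2 p → ∀ (n : ℕ) (m : Fin n → {w : InfinitePlace L // IsComplex w} × Fin 3),
            HasOneSidedJump
              (fun ν : ℝ => hcTwistedDeriv S' n (fun r => hcAdaptedVec w 0 2 (m r)) (orbFamGExt L α ν' a' S') (p + ν • hcNrm w 0 2))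
              (J * hcCayScalar w 0 m * hcTwistedDeriv (insert w S') n (fun r => hcCayVec w 0 2 (m r)) (orbFamGExt L α ν' a' (insert w S')) (hcCayPt w 0 2 p))) :
    ∃ jc' : Finset {w : InfinitePlace L // IsComplex w} → {w : InfinitePlace L // IsComplex w} → Fin 3 → Fin 3 → ℂ,
      ∀ a' : ↥(arch (↥(maximalRealSubfield L)) L (IsCMField.complexConj L) 3 (Matrix.diagonal α)) → ℂ, ArchSmooth L 3 (Matrix.diagonal α) a' →
        ArchHcJump (slotSign L α) jc' (orbFamGExt L α ν' a') := by
  -- choose the wall constants (before the test function)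
  choose J hJ using h02
  -- `jc′ S′ w i j = ε i j · J(S′, w)` on the admissible pairs `(S′, w)`, `0` elsewhere
  refine ⟨fun S' w i j => if (∀ v, v ∈ S' → v ∈ splitChartPlaces L α) ∧ w ∈ splitChartPlaces L α then
      (if i = 0 ∧ j = 2 ∨ i = 2 ∧ j = 1 then 1 else if i = 2 ∧ j = 0 ∨ i = 1 ∧ j = 2 then -1 else 0 : ℂ) *
        (if h : (∀ v, v ∈ S' → v ∈ splitChartPlaces L α) ∧ w ∈ splitChartPlaces L α then (if hw : w ∉ S' then J S' h.1 w hw h.2 else 0) else 0)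
      else 0, fun a' ha' => ?_⟩
  exact archHcJump_orbFamGExt_of_wall02 L α ν' hherm hanis
    (fun S' w => if h : (∀ v, v ∈ S' → v ∈ splitChartPlaces L α) ∧ w ∈ splitChartPlaces L α then (if hw : w ∉ S' then J S' h.1 w hw h.2 else 0) else 0)
    (fun S' hS w hw hsp p hp n m => HasOneSidedJump.jump_congr (hJ S' hS w hw hsp a' ha' p hp n m) (by
      simp only [dif_pos (show (∀ v, v ∈ S' → v ∈ splitChartPlaces L α) ∧ w ∈ splitChartPlaces L α from ⟨hS, hsp⟩), dif_pos hw]))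

/-- **LETTER L1 ASSEMBLED: `∃ jc′, ∀ a′ ∈ C_c^∞(G′_∞), orbFamGExt ν′ a′ ∈ ArchHCSpaceG (slotSign L α) jc′` from (I₁) and the `(0,2)`-wall jump relations.**  In the binder frame of the leaf's
`HcOrbitalFamiliesStatement` (hermitian anisotropic diagonal frame, `ν′` a Haar measure): given (I₁) «every chart member of `orbFamGExt ν′ a′` is `C^∞` on `T_{in-reg}` ★ `InRegG` with
bounded jets near the walls» for every `a′`, and the (I₃) relations at the walls `(w, 0, 2)` of the admissible charts with constants chosen before `a′` (the (B-trans) deliverable),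
there is ONE jump datum `jc′` with `ArchHCSpaceG (slotSign L α) jc′ (orbFamGExt ν′ a′)` for all `a′` — (P), (W), (I₄) are theorems (★ p850216), the one-sided existence half of (I₁)
follows from (I₃) (★ `archHCSpaceG_orbFamGExt_iff_smoothBounded_and_jump`).  After `intro`, this is literally the body of the leaf's L1.
[cite: Varadarajan1977, I §1.12] [cite: Bouaziz1994IntegralesOrbitales, §3.2 p. 580; Thm. 3.2.1 p. 581] [cite: Shelstad1979, Thm. 4.7 (p. 31)] -/
theorem exists_archHCSpaceG_orbFamGExt
    (hherm : ((Matrix.diagonal α).map (cmConjRingHom L)).transpose = Matrix.diagonal α)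
    (hanis : ∀ x : Fin 3 → L, Literature.AlgebraicGeometry.ShimuraVarieties.hermForm (cmConjRingHom L) (Matrix.diagonal α) x x = 0 → x = 0)
    (h1 : ∀ a' : ↥(arch (↥(maximalRealSubfield L)) L (IsCMField.complexConj L) 3 (Matrix.diagonal α)) → ℂ, ArchSmooth L 3 (Matrix.diagonal α) a' →
      ∀ S' : Finset {w : InfinitePlace L // IsComplex w}, ContDiffOn ℝ ∞ (orbFamGExt L α ν' a' S') (InRegG (slotSign L α) S') ∧
        ∀ (n : ℕ) (K : Set ({w : InfinitePlace L // IsComplex w} → Fin 3 → ℝ)), IsCompact K →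
          BddAbove ((fun c => ‖iteratedFDeriv ℝ n (orbFamGExt L α ν' a' S') c‖) '' (K ∩ InRegG (slotSign L α) S')))
    (h02 : ∀ S' : Finset {w : InfinitePlace L // IsComplex w}, (∀ w, w ∈ S' → w ∈ splitChartPlaces L α) →
      ∀ w : {w : InfinitePlace L // IsComplex w}, w ∉ S' → w ∈ splitChartPlaces L α →
        ∃ J : ℂ, ∀ a' : ↥(arch (↥(maximalRealSubfield L)) L (IsCMField.complexConj L) 3 (Matrix.diagonal α)) → ℂ, ArchSmooth L 3 (Matrix.diagonal α) a' →
          ∀ p : {w : InfinitePlace L // IsComplex w} → Fin 3 → ℝ, HcSemireg S' w 0 2 p → ∀ (n : ℕ) (m : Fin n → {w : InfinitePlace L // IsComplex w} × Fin 3),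
            HasOneSidedJump
              (fun ν : ℝ => hcTwistedDeriv S' n (fun r => hcAdaptedVec w 0 2 (m r)) (orbFamGExt L α ν' a' S') (p + ν • hcNrm w 0 2))
              (J * hcCayScalar w 0 m * hcTwistedDeriv (insert w S') n (fun r => hcCayVec w 0 2 (m r)) (orbFamGExt L α ν' a' (insert w S')) (hcCayPt w 0 2 p))) :
    ∃ jc' : Finset {w : InfinitePlace L // IsComplex w} → {w : InfinitePlace L // IsComplex w} → Fin 3 → Fin 3 → ℂ,
      ∀ a' : ↥(arch (↥(maximalRealSubfield L)) L (IsCMField.complexConj L) 3 (Matrix.diagonal α)) → ℂ, ArchSmooth L 3 (Matrix.diagonal α) a' →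
        ArchHCSpaceG (slotSign L α) jc' (orbFamGExt L α ν' a') := by
  have hα : ∀ i, α i ≠ 0 := ne_zero_of_diagonal_anisotropic hanis
  have hreal : ∀ (w : {w : InfinitePlace L // IsComplex w}) (i : Fin 3), (w.1.embedding (α i)).im = 0 :=
    fun w i => im_embedding_diagonal_eq_zero L 3 α (complexConj_apply_eq_of_diagonal_frame hherm) w i
  obtain ⟨jc', hjc'⟩ := exists_archHcJump_orbFamGExt L α ν' hherm hanis h02
  exact ⟨jc', fun a' ha' =>
    (archHCSpaceG_orbFamGExt_iff_smoothBounded_and_jump L α ν' hα hreal (ArchSmooth.hasCompactSupport L 3 (Matrix.diagonal α) ha') jc').2 ⟨h1 a' ha', hjc' a' ha'⟩⟩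

end Assembly

end Literature.NumberTheory.Rogawski1990

end
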